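import Mathlib
import Literature.Geometry.DiscreteGeometry.DelaunaySubdivision
import Literature.Geometry.DiscreteGeometry.DihedralAngleFraction
import Summits.AtomisticToContinuum.Crystallization.Theorems.SquareWellLayerCakeAveragedTwelveLensSix
import Summits.AtomisticToContinuum.Crystallization.Theorems.SquareWellLayerCakeAveragedTwelveGirardCell
import Summits.AtomisticToContinuum.Crystallization.Theorems.SquareWellLayerCakeAveragedTwelveEdgeFlat
import HarnessLib

/-!
# Crux `SquareWellLayerCake.AveragedTwelve` (stmt-AtomisticToContinuum-15806), line `Sketch`
# (idea par-five-delaunay-recount), stub `stub_qrDihedralRange` — dihedral range of a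
# quasi-regular tetrahedron

This file is stub `stub_qrDihedralRange` of line `Sketch` (idea par-five-delaunay-recount) of
crux `SquareWellLayerCake.AveragedTwelve` (stmt-AtomisticToContinuum-15806).

**Statement.** Let `t = {p, z, u, v}` be a cell (a `4`-vertex simplex) of a geometric simplicial
complex in `ℝ³` all of whose six edge lengths lie in `[d, (57/50) d]`, `0 < d` (a *quasi-regular
tetrahedron*).  Then the dihedral fraction of `t` along the edge `pz` at `p` — the fraction of
the unit ball at `p` inside the wedge `ℝ(z − p) + cone(u − p, v − p)` — lies strictly between
`1/7` and `1/4`, i.e. the dihedral angle `α` of `t` at `pz` satisfies `2π/7 < α < π/2`.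

**Proof.** Enumerate `(t ∖ {p}) ∖ {z} = {u, v}` and re-index the wedge
(`ParFiveRecountGirardCell.apexWedge_coe_pair`); the edge vectors `z − p, u − p, v − p` are
linearly independent (`ParFiveRecountEdgeFlat.linearIndependent_edge_vectors`), so by
`dihedralFraction_eq_angle_div` the fraction is `α/2π` with
`α = ∠(perpTo e a, perpTo e b)`, `e = z − p`, `a = u − p`, `b = v − p` (components orthogonal to
the edge).  In the coordinates `H = ⟪e, a⟫/‖e‖` (axial) and `r = ‖perpTo e a‖` (planar radius) one
has `‖a‖² = r² + H²`, `‖a − e‖² = r² + (H − ℓ)²` (`ℓ = ‖e‖`) and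
`‖a − b‖² = r² + r'² − 2P + (H − H')²` with `P = ⟪perpTo e a, perpTo e b⟫`; the six edge-length
constraints are then exactly the hypotheses of the lens estimates of
`ParFiveRecountLensSix`: `lens_point_bounds` gives `r² ≥ d² − ℓ²/4` (and the height bound), and
`planar_inner_le` gives `P ≤ (3/5) r r'`, i.e. `cos α ≤ 3/5`, whence
`α ≥ arccos (3/5) > 2π/7` (`two_pi_lt_seven_arccos`).  For the upper bound,
`2P = r² + r'² + (H − H')² − ‖a − b‖² ≥ 2d² − ℓ²/2 − ρ² ≥ (2 − (3/2)(57/50)²) d² > 0`, so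
`cos α > 0` and `α < π/2`.
-/

noncomputable section

namespace Summit.AtomisticToContinuum.Crystallization.Theorems.ParFiveRecountQrRange

open Real RealInnerProductSpace InnerProductGeometry Literature.Geometry.DiscreteGeometry

/-! ### Axial / planar coordinates relative to an edge vector -/

/-- Pythagoras for the decomposition of `a` into its component orthogonal to `e ≠ 0` and its
axial component: `‖a‖² = ‖perpTo e a‖² + (⟪e, a⟫/‖e‖)²`. [folklore] -/
theorem norm_sq_eq_perp_add_axial {e : EuclideanSpace ℝ (Fin 3)} (he : e ≠ 0)
    (a : EuclideanSpace ℝ (Fin 3)) :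
    ‖a‖ ^ 2 = ‖perpTo e a‖ ^ 2 + (⟪e, a⟫ / ‖e‖) ^ 2 := by
  have hl : (0 : ℝ) < ‖e‖ := norm_pos_iff.2 he
  have h1 : ‖perpTo e a‖ ^ 2 = ‖a‖ ^ 2 - ⟪e, a⟫ ^ 2 / ‖e‖ ^ 2 := by
    rw [← real_inner_self_eq_norm_sq (perpTo e a), inner_perpTo_self he,
      real_inner_self_eq_norm_sq, real_inner_self_eq_norm_sq]
  rw [h1, div_pow]
  ring

/-- The squared distance to the tip of the edge in the same coordinates:
`‖a − e‖² = ‖perpTo e a‖² + (⟪e, a⟫/‖e‖ − ‖e‖)²`. [folklore] -/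
theorem norm_sub_sq_eq_perp_add_axial {e : EuclideanSpace ℝ (Fin 3)} (he : e ≠ 0)
    (a : EuclideanSpace ℝ (Fin 3)) :
    ‖a - e‖ ^ 2 = ‖perpTo e a‖ ^ 2 + (⟪e, a⟫ / ‖e‖ - ‖e‖) ^ 2 := by
  have hl : (0 : ℝ) < ‖e‖ := norm_pos_iff.2 he
  rw [norm_sub_sq_real, norm_sq_eq_perp_add_axial he a, real_inner_comm e a]
  field_simp
  ring

/-- The planar inner product of two vectors relative to the edge vector `e ≠ 0`:
`⟪perpTo e a, perpTo e b⟫ = ⟪a, b⟫ − (⟪e, a⟫/‖e‖)(⟪e, b⟫/‖e‖)`. [folklore] -/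
theorem inner_perpTo_perpTo_eq {e : EuclideanSpace ℝ (Fin 3)} (he : e ≠ 0)
    (a b : EuclideanSpace ℝ (Fin 3)) :
    ⟪perpTo e a, perpTo e b⟫ = ⟪a, b⟫ - ⟪e, a⟫ / ‖e‖ * (⟪e, b⟫ / ‖e‖) := by
  have hl : (0 : ℝ) < ‖e‖ := norm_pos_iff.2 he
  have hee : ⟪e, e⟫ = ‖e‖ ^ 2 := real_inner_self_eq_norm_sq e
  have h1 : ⟪perpTo e a, perpTo e b⟫ = ⟪perpTo e a, b⟫ := by
    rw [perpTo_def e b, inner_sub_right, real_inner_smul_right, inner_perpTo_left, mul_zero,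
      sub_zero]
  rw [h1, perpTo_def, inner_sub_left, real_inner_smul_left, hee]
  field_simp

/-! ### The dihedral angle of a quasi-regular tetrahedron along an edge -/

/-- **Dihedral angle bounds in vector form.** If `e, a, b ∈ ℝ³` have
`‖e‖, ‖a‖, ‖b‖, ‖a − e‖, ‖b − e‖, ‖a − b‖ ∈ [d, (57/50) d]` (`0 < d`), then the angle `α` between
the components of `a` and `b` orthogonal to `e` satisfies `arccos (3/5) ≤ α < π/2`: in axial /
planar coordinates the constraints are the lens bounds of `ParFiveRecountLensSix`, so
`cos α ≤ 3/5` (`planar_inner_le`) and `⟪perpTo e a, perpTo e b⟫ ≥ d² − ‖e‖²/4 − ρ²/2 > 0`.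
[folklore] -/
theorem angle_perpTo_bounds {d : ℝ} (hd : 0 < d) {e a b : EuclideanSpace ℝ (Fin 3)}
    (he : d ≤ ‖e‖ ∧ ‖e‖ ≤ 57 / 50 * d) (ha : d ≤ ‖a‖ ∧ ‖a‖ ≤ 57 / 50 * d)
    (hb : d ≤ ‖b‖ ∧ ‖b‖ ≤ 57 / 50 * d) (hae : d ≤ ‖a - e‖ ∧ ‖a - e‖ ≤ 57 / 50 * d)
    (hbe : d ≤ ‖b - e‖ ∧ ‖b - e‖ ≤ 57 / 50 * d) (hab : d ≤ ‖a - b‖ ∧ ‖a - b‖ ≤ 57 / 50 * d) :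
    arccos (3 / 5) ≤ angle (perpTo e a) (perpTo e b) ∧
      angle (perpTo e a) (perpTo e b) < π / 2 := by
  have hl : 0 < ‖e‖ := hd.trans_le he.1
  have he0 : e ≠ 0 := norm_pos_iff.1 hl
  have ha1 := norm_sq_eq_perp_add_axial he0 a
  have ha2 := norm_sub_sq_eq_perp_add_axial he0 a
  have hb1 := norm_sq_eq_perp_add_axial he0 b
  have hb2 := norm_sub_sq_eq_perp_add_axial he0 b
  have hP := inner_perpTo_perpTo_eq he0 a b
  -- the squared distance of the two apices in axial / planar coordinates
  have habsq : ‖a - b‖ ^ 2 = ‖perpTo e a‖ ^ 2 + ‖perpTo e b‖ ^ 2 - 2 * ⟪perpTo e a, perpTo e b⟫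
      + ((⟪e, a⟫ / ‖e‖ - ‖e‖ / 2) - (⟪e, b⟫ / ‖e‖ - ‖e‖ / 2)) ^ 2 := by
    rw [norm_sub_sq_real, ha1, hb1, hP]
    ring
  have sq_le : ∀ {x y : ℝ}, 0 ≤ x → x ≤ y → x ^ 2 ≤ y ^ 2 := fun hx hxy =>
    pow_le_pow_left₀ hx hxy 2
  -- the lens bounds for the two apices
  have hA := ParFiveRecountLensSix.lens_point_bounds (ℓ := ‖e‖) (ρ := 57 / 50 * d)
    (u := ‖perpTo e a‖ ^ 2) (H := ⟪e, a⟫ / ‖e‖) hd he.1 he.2 le_rfl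
    (by rw [← ha1]; exact sq_le hd.le ha.1) (by rw [← ha1]; exact sq_le (norm_nonneg _) ha.2)
    (by rw [← ha2]; exact sq_le hd.le hae.1) (by rw [← ha2]; exact sq_le (norm_nonneg _) hae.2)
  have hB := ParFiveRecountLensSix.lens_point_bounds (ℓ := ‖e‖) (ρ := 57 / 50 * d)
    (u := ‖perpTo e b‖ ^ 2) (H := ⟪e, b⟫ / ‖e‖) hd he.1 he.2 le_rfl
    (by rw [← hb1]; exact sq_le hd.le hb.1) (by rw [← hb1]; exact sq_le (norm_nonneg _) hb.2)
    (by rw [← hb2]; exact sq_le hd.le hbe.1) (by rw [← hb2]; exact sq_le (norm_nonneg _) hbe.2)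
  have hsep : d ^ 2 ≤ ‖perpTo e a‖ ^ 2 + ‖perpTo e b‖ ^ 2 - 2 * ⟪perpTo e a, perpTo e b⟫
      + ((⟪e, a⟫ / ‖e‖ - ‖e‖ / 2) - (⟪e, b⟫ / ‖e‖ - ‖e‖ / 2)) ^ 2 := by
    rw [← habsq]
    exact sq_le hd.le hab.1
  -- `cos α ≤ 3/5`
  have hPle : ⟪perpTo e a, perpTo e b⟫ ≤ 3 / 5 * (‖perpTo e a‖ * ‖perpTo e b‖) :=
    ParFiveRecountLensSix.planar_inner_le hd he.1 he.2 le_rfl (norm_nonneg _) rfl (norm_nonneg _)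
      rfl hA.1 hA.2 hB.1 hB.2 hsep
  -- `cos α > 0`
  have hab2 : ‖a - b‖ ^ 2 ≤ (57 / 50 * d) ^ 2 := sq_le (norm_nonneg _) hab.2
  have hl2 : ‖e‖ ^ 2 ≤ (57 / 50 * d) ^ 2 := sq_le (norm_nonneg _) he.2
  have hPpos : 0 < ⟪perpTo e a, perpTo e b⟫ := by
    nlinarith [hA.2, hB.2, habsq, hab2, hl2, hd,
      sq_nonneg ((⟪e, a⟫ / ‖e‖ - ‖e‖ / 2) - (⟪e, b⟫ / ‖e‖ - ‖e‖ / 2))]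
  -- the planar radii are positive
  have hApos : 0 < ‖perpTo e a‖ := by
    rcases (norm_nonneg (perpTo e a)).lt_or_eq with h | h
    · exact h
    · have h2 := hA.2
      rw [← h] at h2
      nlinarith [hl2, hd]
  have hBpos : 0 < ‖perpTo e b‖ := by
    rcases (norm_nonneg (perpTo e b)).lt_or_eq with h | h
    · exact h
    · have h2 := hB.2
      rw [← h] at h2
      nlinarith [hl2, hd]
  have hAB : 0 < ‖perpTo e a‖ * ‖perpTo e b‖ := mul_pos hApos hBpos
  have hcos_le : ⟪perpTo e a, perpTo e b⟫ / (‖perpTo e a‖ * ‖perpTo e b‖) ≤ 3 / 5 := by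
    rw [div_le_iff₀ hAB]
    linarith
  have hcos_pos : 0 < ⟪perpTo e a, perpTo e b⟫ / (‖perpTo e a‖ * ‖perpTo e b‖) :=
    div_pos hPpos hAB
  unfold angle
  exact ⟨arccos_le_arccos hcos_le, arccos_lt_pi_div_two.2 hcos_pos⟩

/-! ### The statement -/

/-- **Dihedral range of a quasi-regular tetrahedron** (stub `stub_qrDihedralRange` of line
`Sketch`, crux `SquareWellLayerCake.AveragedTwelve`).  For a cell `t` of a geometric simplicial
complex in `ℝ³` with all edge lengths in `[d, (57/50) d]`, `0 < d`, a vertex `p ∈ t` and a second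
vertex `z ∈ t`, the dihedral fraction of `t` along `pz` at `p` lies in `(1/7, 1/4)` (the dihedral
angle lies in `(2π/7, π/2)`). -/
theorem stub_qrDihedralRange : ∀ (d : ℝ), 0 < d → ∀ (K : Geometry.SimplicialComplex ℝ (EuclideanSpace ℝ (Fin 3))) (t : Finset (EuclideanSpace ℝ (Fin 3))), t ∈ K.faces → t.card = 4 → (∀ a ∈ t, ∀ b ∈ t, a ≠ b → d ≤ dist a b ∧ dist a b ≤ 57 / 50 * d) → ∀ p ∈ t, ∀ z ∈ t.erase p, 1 / 7 < Literature.Geometry.DiscreteGeometry.ballFraction p (Literature.Geometry.DiscreteGeometry.apexWedge p (z - p) (fun w : ↥(((t).erase p).erase z) => (↑w : EuclideanSpace ℝ (Fin 3)) - p)) ∧ Literature.Geometry.DiscreteGeometry.ballFraction p (Literature.Geometry.DiscreteGeometry.apexWedge p (z - p) (fun w : ↥(((t).erase p).erase z) => (↑w : EuclideanSpace ℝ (Fin 3)) - p)) < 1 / 4 := by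
  intro d hd K t ht hcard hqr p hp z hz
  -- enumerate the two remaining vertices `(t ∖ {p}) ∖ {z} = {u, v}`
  obtain ⟨hzp, hzt⟩ := Finset.mem_erase.1 hz
  have h2 : ((t.erase p).erase z).card = 2 := by
    rw [Finset.card_erase_of_mem hz, Finset.card_erase_of_mem hp, hcard]
  obtain ⟨u, v, huv, hs⟩ := Finset.card_eq_two.1 h2
  have hu : u ∈ (t.erase p).erase z := by rw [hs]; simp
  have hv : v ∈ (t.erase p).erase z := by rw [hs]; simp
  have hmem : ∀ w, w ∈ (t.erase p).erase z ↔ w = u ∨ w = v := fun w => by rw [hs]; simp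
  obtain ⟨huz, hu'⟩ := Finset.mem_erase.1 hu
  obtain ⟨hup, hut⟩ := Finset.mem_erase.1 hu'
  obtain ⟨hvz, hv'⟩ := Finset.mem_erase.1 hv
  obtain ⟨hvp, hvt⟩ := Finset.mem_erase.1 hv'
  -- non-degeneracy and the dihedral formula
  have hli : LinearIndependent ℝ ![z - p, u - p, v - p] :=
    ParFiveRecountEdgeFlat.linearIndependent_edge_vectors ht hp hz hu hv huv
  rw [ParFiveRecountGirardCell.apexWedge_coe_pair p (z - p) (fun x => x - p) huv _ hmem]
  have key : ballFraction p (apexWedge p (z - p) ![u - p, v - p]) =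
      angle (perpTo (z - p) (u - p)) (perpTo (z - p) (v - p)) / (2 * π) :=
    dihedralFraction_eq_angle_div p z ![u - p, v - p] hli
  rw [key]
  -- the six edge lengths
  have he : d ≤ ‖z - p‖ ∧ ‖z - p‖ ≤ 57 / 50 * d := by
    rw [← dist_eq_norm]; exact hqr z hzt p hp hzp
  have ha : d ≤ ‖u - p‖ ∧ ‖u - p‖ ≤ 57 / 50 * d := by
    rw [← dist_eq_norm]; exact hqr u hut p hp hup
  have hb : d ≤ ‖v - p‖ ∧ ‖v - p‖ ≤ 57 / 50 * d := by
    rw [← dist_eq_norm]; exact hqr v hvt p hp hvp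
  have hae : d ≤ ‖u - p - (z - p)‖ ∧ ‖u - p - (z - p)‖ ≤ 57 / 50 * d := by
    rw [sub_sub_sub_cancel_right, ← dist_eq_norm]; exact hqr u hut z hzt huz
  have hbe : d ≤ ‖v - p - (z - p)‖ ∧ ‖v - p - (z - p)‖ ≤ 57 / 50 * d := by
    rw [sub_sub_sub_cancel_right, ← dist_eq_norm]; exact hqr v hvt z hzt hvz
  have hab : d ≤ ‖u - p - (v - p)‖ ∧ ‖u - p - (v - p)‖ ≤ 57 / 50 * d := by
    rw [sub_sub_sub_cancel_right, ← dist_eq_norm]; exact hqr u hut v hvt huv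
  obtain ⟨hlo, hhi⟩ := angle_perpTo_bounds hd he ha hb hae hbe hab
  have h7 := ParFiveRecountLensSix.two_pi_lt_seven_arccos
  have hπ : 0 < 2 * π := by positivity
  constructor
  · rw [lt_div_iff₀ hπ]
    linarith
  · rw [div_lt_iff₀ hπ]
    linarith

end Summit.AtomisticToContinuum.Crystallization.Theorems.ParFiveRecountQrRange

end
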